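import Summits.QuantumFields.BalabanUV.T4Continuum.Spine.NE1p.DressedSuppliedCompositionWitness

/-!
# T⁴ programme, spine estimate NE1′ (node O3b/H2) — GENUINE ABSORPTION ON THE COMPOSITION FACE OF RECORD, PART 1: THE DATUM
# `towerR` (births PAY WITH the absorbed older mass: `absorbs b = {b−1}`, `A = ⅛`, `β₀ = ½`), row S3u §2's function-level binders and
# the supplier data with a LIVE absorption law (crew row W37 = DAG N29zt, typer R-T113 (iv) OPEN OFFER ∕ R-T114 (iii-a); INTENT HOME/CLAIMS.log 2026-08-20)

Cell `pub-balaban`, sub-cell `t4`, BINDER-OWNERS row NE1′, crew `b2b-balaban-t4-ne1p-formalise-*`, seat `leaf-02` (gen 13; lineage S3i ∕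
S5e ∕ W8 ∕ W32).  ADDITIVE — imports W32 `Spine/NE1p/DressedSuppliedCompositionWitness` (p224870) ONLY and through it row S3u
`DressedStabilityStrictOfSuppliedComposition` (p218916), W20 `DressedValueMapWitness` (p219129: the push `vmap`, `norm_vmap`,
`vmap_affine`, `theta_pow_le_one`) and W18's chart conventions; toy DATA `def`s + theorems; nothing of S3u ∕ S5e ∕ S5b ∕ W18 ∕ W20 ∕
W32 is restated.  PART 2 (`…WitnessEnd`) applies the three supplied ENDs and proves the GENUINENESS records.

WHY.  W32 applied row S3u §2 on W18's `towerC` and PROVED (§5 `beta0_ge_one_of_absorbLaw`, `A0_le_one_of_window`,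
`absorption_weightless`) that on that datum EVERY ℝ-step feeding the END carries a WEIGHTLESS absorbed mass (`A·N = 0`): births ON
the class force `1 ≤ β₀`, the pinned gate forces `A₀ ≤ 1`, and row S5b's window then kills `A·N`.  So the END's absorption
binders — `A`, the ℝ-step's `absorbs` with the absorbed sum of `hlaw : AbsorbLaw`, S5e's absorbed COUNT, S5b's `hfan`∕`hamp` with a
live fan-out — had no (γ)-route applier with `A·N > 0` (W13∕W30's genuine absorption is the (α′) face's).  The cure W32 located:
births strictly INSIDE the class with window room.  THIS PART decides such a datum:
* §1 `towerR` [decided toy]: at cutoff `K` one family per birth scale `j ≤ K` on the complex line exactly as W18 (chart `U + t·d`,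
  window `closedBall 0 1`, relation `=`, W20's push), but the carried coefficient is DEFINED BY THE ABSORPTION RECURSION
  `12·cR K (j+1) = ½·(⅛)^(K−(j+1)) + ⅜·cR K j`, `12·cR K 0 = ½·(⅛)^K`: the birth size `4·gen b b = 12·cR K b` IS the dressing
  `βR K b = ½·(⅛)^(K−b)` PLUS `⅛ ×` the pre-ℝ mass `3·cR K (b−1)` of the absorbed next-older family; the ℝ-step `RsR K` has
  `absorbs b = {b−1}`, `comp b = {cube b}`, `pre := ψ·envVar(·, k−1)` (EQUALITY seam, as W30∕W32), `δ = βR`; anchoring `anchR K` at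
  the origin block (`mB = v = 1`), capped live sets `SR`, one-cube components `compR`.
* §2 S3u §2's function-level binders (`hG_R` F-1 at birth, SHARP sup `3·cR`; `hinv_R`; `hVK_R`∕`hVrel_R` by W20's push; `hneX_R`∕`hsupX_R`
  the booking convention on unit pairs ATTAINED; `hreg_R` (w5) idle as W18); §3 the supplier data (`hmult_R`, `hscale_R`, `hhoused_R`,
  `hvol_R`, `compVol_RsR`, `preBelowEnv_RsR` an equality seam, `absorbed_sum_eq`, **`absorbLaw_eq` — `AbsorbLaw` WITH EQUALITY AND A
  LIVE A-TERM**, `hβ_R`).  Planted mutants (NOT filed; rc 1 each): the `⅜·cR K j` term dropped from the recursion (`cR_succ`, hence `absorbLaw_eq`),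
  `absorbsR := ∅` (`absorbed_sum_eq`), `SR` uncapped (`hhoused_R`).

HONEST FRAMING (c4; offered wording, typer R-T113 (iv)).  «Row S3u §2's supplied ENDs fire on a decided (γ)-datum with a WEIGHTED
absorbed mass (`A·vR·mB = ⅛`, `absorbs b = {b−1}`, `hlaw` an equality whose A-term is load-bearing), births strictly inside the class
(≤ 16∕31 of it) and window room (amplitude ⅔) — the cure W32 §5 located; `Anchoring` (row S3i) and `RStep` (row O3.E-iii-c
`T4PreservedUnderR.RStep`) are the crew's SHAPES and the seams are equalities BY DEFINITION; SOCKET COMPOSITION certified, NOT that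
an ℝ-operation ∕ minimisers ∕ components of [Balaban1989LargeFieldII] were constructed or bounded; S3v's supplied ENDs untouched;
discharges no wall item; the wall line v1.6 does NOT move; R-t4r2-Q2 NOT met thereby; NE1′ NOT proved.»  [decided toy] ∕ [folklore];
0 `def … : Prop`; 0 citations (the bracketed paper name is the rider's wording, no locus used).  NE1′ NOT printed, NOT proved; spine
PROVED 0∕9; count 9 unchanged.  Rung (B)+1 on ONE finite four-torus — NOT infinite volume, NOT a mass gap, NOT OS on ℝ⁴, NOT Clay.
HONEST DEPENDENCY: continuum YM on T⁴ ⇐ BetaPertH ∧ nine spine estimates (0/9 proved); BetaPertH ⇐ (D1) ∧ (D4) ∧ CAP+tail; G-an2-4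
gates asym, D1 and NE2/3/4.
-/

noncomputable section

namespace Summit.QuantumFields.BalabanUV.T4Continuum.NE1p.DressedSuppliedAbsorptionWitness

open Set Metric Finset
open scoped BigOperators
open Literature.MathematicalPhysics.QuantumFieldTheory.Balaban1983to89
open Literature.MathematicalPhysics.QuantumFieldTheory.Balaban1983to89.T4TermFormat
open Literature.MathematicalPhysics.QuantumFieldTheory.Balaban1983to89.T4FeltGeometry
open Literature.MathematicalPhysics.QuantumFieldTheory.Balaban1983to89.T4TrajectoryComparison
open Literature.MathematicalPhysics.QuantumFieldTheory.Balaban1983to89.T4BirthChartTransport (GaugeInvariant BirthSlice RelGauge)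
open Literature.MathematicalPhysics.QuantumFieldTheory.Balaban1983to89.T4PreservedUnderR (RStep)
open Summit.QuantumFields.BalabanUV.T4Continuum.T4TrajectoryDensityDressed
open Summit.QuantumFields.BalabanUV.T4Continuum.NE1p.DressedRoot (DressedTower)
open Summit.QuantumFields.BalabanUV.T4Continuum.NE1p.DressedValueMapWitness (vmap norm_vmap vmap_affine theta_pow_le_one)

/-! ## §1 The datum: births pay with the absorbed older mass -/

/-- CARRIED COEFFICIENT of the family born at scale `j` (cutoff `K`), BY THE ABSORPTION RECURSION [decided toy]:
`12·cR K 0 = ½·(⅛)^K`, `12·cR K (j+1) = ½·(⅛)^(K−(j+1)) + ⅜·cR K j` (dressing `β₀ = ½` of the class + `A = ⅛` times the absorbed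
family's pre-ℝ mass `3·cR K j`). [folklore] -/
def cR (K : ℕ) : ℕ → ℝ
  | 0 => (1 / 2 : ℝ) * (1 / 8 : ℝ) ^ K / 12
  | j + 1 => ((1 / 2 : ℝ) * (1 / 8 : ℝ) ^ (K - (j + 1)) + (3 / 8 : ℝ) * cR K j) / 12

/-- [folklore] The recursion's base. -/
theorem cR_zero (K : ℕ) : 12 * cR K 0 = (1 / 2 : ℝ) * (1 / 8 : ℝ) ^ K := by simp only [cR]; ring

/-- [folklore] The recursion's step — the absorption law in coefficients. -/
theorem cR_succ (K j : ℕ) : 12 * cR K (j + 1) = (1 / 2 : ℝ) * (1 / 8 : ℝ) ^ (K - (j + 1)) + (3 / 8 : ℝ) * cR K j := by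
  simp only [cR]; ring

/-- [folklore] The coefficients are positive. -/
theorem cR_pos (K : ℕ) : ∀ j, 0 < cR K j
  | 0 => by simp only [cR]; positivity
  | j + 1 => by have := cR_pos K j; simp only [cR]; positivity

/-- DRESSING SIZES [decided toy]: `βR K j = ½·(⅛)^(K−j)` — HALF the class at birth (`β₀ = ½`, `τ = L⁻³ = ⅛`). [folklore] -/
def βR (K j : ℕ) : ℝ := (1 / 2 : ℝ) * (1 / 8 : ℝ) ^ (K - j)

/-- BOOKED SIZE of the family born at `b`, at scale `k`: coefficient × the pushed unit defect `(¼)^(k−b)` [decided toy]. [folklore] -/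
def sizeR (K b k : ℕ) : ℝ := cR K b * (1 / 4 : ℝ) ^ (k - b)

/-- [folklore] Booked sizes are positive. -/
theorem sizeR_pos (K b k : ℕ) : 0 < sizeR K b k := by unfold sizeR; exact mul_pos (cR_pos K b) (by positivity)

/-- THE BOOKING at cutoff `K` [decided toy]: births `Fin (K+1)` (one per scale), cubes `Fin (K+1)` (one per scale), every alive family
felt at every later cube, sizes `sizeR` — W18's index geometry with the new sizes. [folklore] -/
def BR (K : ℕ) : T4TermFormat.Booking where
  K := K
  Dom := Fin (K + 1)
  domScale := fun X => X.val
  treeLen := fun _ => 0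
  treeLen_nonneg := fun _ => le_rfl
  balSize := fun _ => 0
  Birth := Fin (K + 1)
  births := Finset.univ
  mem_births := fun b => Finset.mem_univ b
  birthScale := fun b => b.val
  birth_le := fun b => Nat.lt_succ_iff.mp b.isLt
  loc := fun b => b
  loc_scale := fun _ => rfl
  Cube := Fin (K + 1)
  cubes := Finset.univ
  mem_cubes := fun q => Finset.mem_univ q
  cubeScale := fun q => q.val
  cube_le := fun q => Nat.lt_succ_iff.mp q.isLt
  feltAt := fun q => Finset.univ.filter fun b : Fin (K + 1) => b.val ≤ q.val
  felt_birth_le := fun _ _ hb => (Finset.mem_filter.mp hb).2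
  size := fun b k => sizeR K b.val k
  size_nonneg := fun b k => (sizeR_pos K b.val k).le
  pair := fun _ _ _ => 0

/-- THE TRAJECTORY at cutoff `K` [decided toy]: one generation per family, birth size `gen b b = 3·cR K b` (the sharp sup of the carried
function on its slice domain), re-linearised size = the booked size; births only. [folklore] -/
def TR (K : ℕ) : Trajectory (BR K) where
  lin := fun b k' k => if k' = b.val then sizeR K b.val k else 0
  lin_nonneg := fun b k' k => by split_ifs <;> [exact (sizeR_pos K b.val k).le; exact le_rfl]
  gen := fun b k' => if k' = b.val then 3 * cR K b.val else 0
  gen_nonneg := fun b k' => by split_ifs <;> [exact (mul_pos (by norm_num) (cR_pos K b.val)).le; exact le_rfl]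
  size_le := fun b k hbk _ => by
    change b.val ≤ k at hbk
    show sizeR K b.val k ≤ ∑ k' ∈ Icc b.val k, (if k' = b.val then sizeR K b.val k else 0)
    rw [Finset.sum_ite_eq' (Icc b.val k) b.val (fun _ => sizeR K b.val k), if_pos (Finset.mem_Icc.mpr ⟨le_rfl, hbk⟩)]

/-- THE TOWER [decided toy]: the datum at every cutoff (one run parameter). [folklore] -/
def towerR : DressedTower Unit where
  B := fun _ K => BR K
  K_eq := fun _ _ => rfl
  T := fun _ K => TR K

/-- THE CARRIED FUNCTION of generation `k′` of family `b` on the complex line [decided toy]: the birth generation is `U ↦ cR K b · U`,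
later generations are absent. [folklore] -/
def FnR (K : ℕ) (b : Fin (K + 1)) (k' : ℕ) (U : ℂ) : ℂ := if k' = b.val then (cR K b.val : ℂ) * U else 0

/-- THE LIVE FAMILIES of a step-`k` component, CAPPED at the cutoff [decided toy]: those born at scales `≤ k`; none above `K`. [folklore] -/
def SR (K k : ℕ) (_b : Fin (K + 1)) : Finset (Fin (K + 1)) :=
  if k ≤ K then Finset.univ.filter fun f : Fin (K + 1) => f.val ≤ k else ∅

/-- THE COMPONENT of a step-`k` family [decided toy]: THE cube of scale `k`. [folklore] -/
def compR (K k : ℕ) (_b : Fin (K + 1)) : Finset (Fin (K + 1)) := Finset.univ.filter fun q : Fin (K + 1) => q.val = k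

/-- THE ANCHORING on `ℕ⁴` at the blocking integer `2` [decided toy]: every domain and cube block is the origin block. [folklore] -/
def anchR (K : ℕ) : Anchoring (BR K) 4 2 where
  dom := fun _ => {0}
  center := fun _ => 0
  felt_under := fun q b _ => ⟨0, mem_singleton_self _, funext fun i => by simp [coarsen]⟩

/-- THE ABSORBED FAMILIES [decided toy]: the family born at `b ≥ 1` absorbs the NEXT-OLDER family `b−1`; the oldest absorbs nobody. [folklore] -/
def absorbsR (K : ℕ) (b : Fin (K + 1)) : Finset (Fin (K + 1)) :=
  if 1 ≤ b.val then {⟨b.val - 1, lt_of_le_of_lt (Nat.sub_le _ _) b.isLt⟩} else ∅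

/-- PRE-ℝ SIZE of `b` before the ℝ-operation of scale `k` [decided toy]: the rate times the dressed envelope at `k−1` (EQUALITY seam). [folklore] -/
def preR (K : ℕ) (b : Fin (K + 1)) (k : ℕ) : ℝ :=
  (((2 : ℝ) ^ 2)⁻¹ * 1) * (TR K).envVar (4 * 1 / 1) (fun _ : ℕ => ((2 : ℝ) ^ 2)⁻¹ * 1) b (k - 1)

/-- THE ℝ-STEP DATUM over `BR K` [decided toy]: `pre = preR`, `absorbs = absorbsR` (GENUINE), component = the birth cube, `δ = βR`. [folklore] -/
def RsR (K : ℕ) : RStep (BR K) where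
  pre := preR K
  pre_nonneg := fun b k => mul_nonneg (by norm_num)
    (Trajectory.envVar_nonneg (by norm_num) (fun _ => by norm_num) b (k - 1))
  absorbs := absorbsR K
  absorbs_lt := fun b' b hb => by
    change b.val < b'.val
    unfold absorbsR at hb
    split_ifs at hb with h
    · rw [Finset.mem_singleton.mp hb]; exact Nat.sub_lt_of_pos_le (by norm_num) h
    · exact absurd hb (Finset.notMem_empty _)
  comp := fun b => {b}
  comp_scale := fun b q hq => by rw [Finset.mem_singleton.mp hq]; rfl
  absorbs_felt := fun b' b hb => by
    refine ⟨b', Finset.mem_singleton_self _, Finset.mem_filter.mpr ⟨Finset.mem_univ (α := Fin (K + 1)) b, ?_⟩⟩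
    unfold absorbsR at hb
    split_ifs at hb with h
    · rw [Finset.mem_singleton.mp hb]; exact Nat.sub_le _ _
    · exact absurd hb (Finset.notMem_empty _)
  δ := fun b => βR K b.val
  δ_nonneg := fun b => by unfold βR; positivity

/-! ## §2 Row S3u §2's function-level binders on the datum -/

/-- **F-1 AT BIRTH** [decided toy]: a `BirthSlice` along the affine chart (window `1`, radius `1`, `closedBall 0 1`), SHARP sup `3·cR K b`; any history. [folklore] -/
theorem hG_R (K : ℕ) (Gate : ℕ → Prop) : ∀ (b : (BR K).Birth) (k' : ℕ), (BR K).birthScale b ≤ k' → k' ≤ (BR K).K →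
    RanBelow Gate k' → BirthSlice (FnR K b k') (fun U d t => U + t * d) (fun d : ℂ => ‖d‖) (closedBall (0 : ℂ) 1) 1 1 ((TR K).gen b k') := by
  intro b k' _ _ _ U hU d hd hdw
  show ∃ Dm : Set ℂ, DifferentiableOn ℂ (fun t : ℂ => FnR K b k' (U + t * d)) Dm ∧
      (∀ t ∈ Dm, ‖FnR K b k' (U + t * d)‖ ≤ (if k' = b.val then 3 * cR K b.val else 0)) ∧
      ∀ s ∈ Set.Icc (0 : ℝ) 1, closedBall (s : ℂ) (1 / ‖d‖) ⊆ Dm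
  by_cases hk' : k' = b.val
  · refine ⟨closedBall (0 : ℂ) (1 + 1 / ‖d‖), ?_, ?_, ?_⟩
    · unfold FnR
      simp only [if_pos hk']
      exact ((differentiable_const _).mul ((differentiable_const _).add
        (differentiable_id.mul (differentiable_const _)))).differentiableOn
    · intro t ht
      rw [if_pos hk']
      unfold FnR
      rw [if_pos hk', norm_mul, Complex.norm_real, Real.norm_of_nonneg (cR_pos K b.val).le, mul_comm]
      refine mul_le_mul_of_nonneg_right ?_ (cR_pos K b.val).le
      have htd : ‖t‖ * ‖d‖ ≤ (1 + 1 / ‖d‖) * ‖d‖ := mul_le_mul_of_nonneg_right (mem_closedBall_zero_iff.mp ht) (norm_nonneg d)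
      rw [add_mul, one_mul, one_div, inv_mul_cancel₀ hd.ne'] at htd
      calc ‖U + t * d‖ ≤ ‖U‖ + ‖t‖ * ‖d‖ := (norm_add_le _ _).trans (by rw [norm_mul])
        _ ≤ 1 + (‖d‖ + 1) := add_le_add (mem_closedBall_zero_iff.mp hU) htd
        _ ≤ 3 := by linarith
    · intro s hs t ht
      rw [mem_closedBall, dist_eq_norm] at ht
      have h2 : ‖(s : ℂ)‖ ≤ 1 := by rw [Complex.norm_real, Real.norm_of_nonneg hs.1]; exact hs.2
      rw [mem_closedBall_zero_iff]
      calc ‖t‖ = ‖t - (s : ℂ) + (s : ℂ)‖ := by rw [sub_add_cancel]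
        _ ≤ ‖t - (s : ℂ)‖ + ‖(s : ℂ)‖ := norm_add_le _ _
        _ ≤ 1 / ‖d‖ + 1 := add_le_add ht h2
        _ = 1 + 1 / ‖d‖ := add_comm _ _
  · refine ⟨Set.univ, ?_, ?_, fun _ _ => Set.subset_univ _⟩
    · unfold FnR
      simp only [if_neg hk']
      exact differentiableOn_const 0
    · intro t _
      unfold FnR
      simp [hk']

/-- `hinv`: the carried functions are invariant under the (trivial) relation `=`. [folklore] -/
theorem hinv_R (K : ℕ) (b : (BR K).Birth) (k' : ℕ) : GaugeInvariant (fun U U' : ℂ => U = U') (FnR K b k') :=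
  fun _ _ h => by rw [h]

/-- `hVK` — containment of W20's push (GENUINE: radius `θ^(k−k′) ≤ 1`). [folklore] -/
theorem hVK_R (K : ℕ) : ∀ (b : (BR K).Birth) (k' k : ℕ), (BR K).birthScale b ≤ k' → k' ≤ k → k ≤ (BR K).K →
    ∀ X₀ ∈ closedBall (0 : ℂ) 1, vmap k' k X₀ ∈ closedBall (0 : ℂ) 1 := by
  intro b k' k _ _ _ X₀ hX₀
  rw [mem_closedBall_zero_iff] at hX₀ ⊢
  rw [norm_vmap]
  calc (1 / 4 : ℝ) ^ (k - k') * ‖X₀‖ ≤ 1 * 1 := mul_le_mul (theta_pow_le_one _) hX₀ (norm_nonneg _) zero_le_one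
    _ = 1 := one_mul _

/-- `hVrel` — felt-size contraction PERFORMED by W20's push (linearity). [folklore] -/
theorem hVrel_R (K : ℕ) : ∀ (b : (BR K).Birth) (k' k : ℕ), (BR K).birthScale b ≤ k' → k' ≤ k → k ≤ (BR K).K →
    ∀ X₀ ∈ closedBall (0 : ℂ) 1, ∀ X₁ : ℂ, ∀ δ : ℝ,
      RelGauge (fun U U' : ℂ => U = U') (fun U d t => U + t * d) (fun d : ℂ => ‖d‖) X₀ X₁ δ →
      RelGauge (fun U U' : ℂ => U = U') (fun U d t => U + t * d) (fun d : ℂ => ‖d‖) (vmap k' k X₀) (vmap k' k X₁)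
        ((1 / 4 : ℝ) ^ (k - k') * δ) := by
  intro b k' k _ _ _ X₀ _ X₁ δ h
  obtain ⟨d, hd0, hdδ, hX₁⟩ := h
  refine ⟨vmap k' k d, ?_, ?_, ?_⟩
  · show 0 < ‖vmap k' k d‖
    rw [norm_vmap]; exact mul_pos (by positivity) hd0
  · show ‖vmap k' k d‖ ≤ (1 / 4 : ℝ) ^ (k - k') * δ
    rw [norm_vmap]; exact mul_le_mul_of_nonneg_left hdδ (by positivity)
  · show vmap k' k X₁ = vmap k' k X₀ + 1 * vmap k' k d
    rw [show X₁ = X₀ + 1 * d from hX₁, vmap_affine]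

/-- `hneX` — admissible unit pairs exist at every scale: `(0, 0 + 1·1)`; any history. [folklore] -/
theorem hneX_R (K : ℕ) (Gate : ℕ → Prop) : ∀ (b : (BR K).Birth) (k' k : ℕ), (BR K).birthScale b ≤ k' → k' ≤ k → k ≤ (BR K).K →
    RanBelow Gate k → ∃ X₀ ∈ closedBall (0 : ℂ) 1, ∃ X₁ : ℂ,
      RelGauge (fun U U' : ℂ => U = U') (fun U d t => U + t * d) (fun d : ℂ => ‖d‖) X₀ X₁ ((fun _ : ℕ => (1 : ℝ)) k) :=
  fun _ _ _ _ _ _ _ => ⟨0, mem_closedBall_self zero_le_one, 0 + 1 * 1, 1, by simp, by simp, rfl⟩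

/-- [folklore] The composed increment over a scale-`k` unit pair: `≤ cR K b · θ^(k−k′)` for the birth generation, `0` otherwise. -/
theorem composed_increment_le (K : ℕ) (b : (BR K).Birth) (k' k : ℕ) {X₀ X₁ : ℂ}
    (h : RelGauge (fun U U' : ℂ => U = U') (fun U d t => U + t * d) (fun d : ℂ => ‖d‖) X₀ X₁ 1) :
    ‖FnR K b k' (vmap k' k X₁) - FnR K b k' (vmap k' k X₀)‖ ≤ if k' = b.val then cR K b.val * (1 / 4 : ℝ) ^ (k - k') else 0 := by
  obtain ⟨d, _, hd1, hX₁⟩ := h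
  have hX : X₁ = X₀ + 1 * d := hX₁
  unfold FnR
  by_cases hk' : k' = b.val
  · rw [if_pos hk', if_pos hk', if_pos hk', ← mul_sub, hX, vmap_affine, add_sub_cancel_left, one_mul, norm_mul,
      Complex.norm_real, Real.norm_of_nonneg (cR_pos K b.val).le, norm_vmap]
    refine mul_le_mul_of_nonneg_left ?_ (cR_pos K b.val).le
    calc (1 / 4 : ℝ) ^ (k - k') * ‖d‖ ≤ (1 / 4 : ℝ) ^ (k - k') * 1 := mul_le_mul_of_nonneg_left hd1 (by positivity)
      _ = (1 / 4 : ℝ) ^ (k - k') := mul_one _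
  · rw [if_neg hk', if_neg hk', if_neg hk', sub_zero, norm_zero]

/-- [folklore] … and the UNIT pair `(0, 1)` ATTAINS it: the booked size is the composed increment, no slack. -/
theorem composed_increment_unit (K : ℕ) (b : (BR K).Birth) (k : ℕ) :
    ‖FnR K b b.val (vmap b.val k (0 + 1 * 1)) - FnR K b b.val (vmap b.val k 0)‖ = sizeR K b.val k := by
  unfold FnR sizeR
  rw [if_pos rfl, if_pos rfl, zero_add, one_mul, ← mul_sub]
  unfold vmap
  rw [mul_zero, mul_one, sub_zero, norm_mul, Complex.norm_real, Complex.norm_real, Real.norm_of_nonneg (cR_pos K b.val).le,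
    Real.norm_of_nonneg (by positivity)]

/-- `hsupX` — the booking convention on unit pairs, ATTAINED (`le_csSup`); any history. [folklore] -/
theorem hsupX_R (K : ℕ) (Gate : ℕ → Prop) : ∀ (b : (BR K).Birth) (k' k : ℕ), (BR K).birthScale b ≤ k' → k' ≤ k → k ≤ (BR K).K →
    RanBelow Gate k → (TR K).lin b k' k ≤ sSup {x : ℝ | ∃ X₀ ∈ closedBall (0 : ℂ) 1, ∃ X₁ : ℂ,
      RelGauge (fun U U' : ℂ => U = U') (fun U d t => U + t * d) (fun d : ℂ => ‖d‖) X₀ X₁ ((fun _ : ℕ => (1 : ℝ)) k) ∧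
        x = ‖FnR K b k' (vmap k' k X₁) - FnR K b k' (vmap k' k X₀)‖} := by
  intro b k' k _ _ _ _
  have hbdd : BddAbove {x : ℝ | ∃ X₀ ∈ closedBall (0 : ℂ) 1, ∃ X₁ : ℂ,
      RelGauge (fun U U' : ℂ => U = U') (fun U d t => U + t * d) (fun d : ℂ => ‖d‖) X₀ X₁ ((fun _ : ℕ => (1 : ℝ)) k) ∧
        x = ‖FnR K b k' (vmap k' k X₁) - FnR K b k' (vmap k' k X₀)‖} := by
    refine ⟨if k' = b.val then cR K b.val * (1 / 4 : ℝ) ^ (k - k') else 0, ?_⟩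
    rintro x ⟨X₀, -, X₁, hrel, rfl⟩
    exact composed_increment_le K b k' k hrel
  show (if k' = b.val then sizeR K b.val k else 0) ≤ _
  by_cases hk' : k' = b.val
  · rw [if_pos hk']
    refine le_csSup hbdd ⟨0, mem_closedBall_self zero_le_one, 0 + 1 * 1, ⟨1, by simp, by simp, rfl⟩, ?_⟩
    rw [hk', composed_increment_unit]
  · rw [if_neg hk']
    exact Real.sSup_nonneg (by rintro x ⟨_, -, _, -, rfl⟩; exact norm_nonneg _)

/-- (w5) `hreg`: births only — regeneration holds with the constant `0` (idle on this toy, as W18); any history. [folklore] -/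
theorem hreg_R (K : ℕ) (Gate : ℕ → Prop) : (TR K).RegeneratesFromVar (fun _ : ℕ => (0 : ℝ)) Gate := by
  intro b k hbk _ _
  show (if k + 1 = b.val then 3 * cR K b.val else 0) ≤ 0 * sizeR K b.val k
  have hne : k + 1 ≠ b.val := by change b.val ≤ k at hbk; omega
  rw [if_neg hne, zero_mul]

/-! ## §3 The supplier data: anchoring, housing, the ℝ-step with a LIVE absorption law, the window with ROOM -/

/-- `hmult`: per-block multiplicity `mB = 1`. [folklore] -/
theorem hmult_R (K : ℕ) : ∀ (j : ℕ) (x : Fin 4 → ℕ),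
    ((BR K).births.filter fun b => (BR K).birthScale b = j ∧ x ∈ (anchR K).dom b).card ≤ 1 :=
  fun _ _ => card_le_one.mpr fun _ hf _ hf' => Fin.ext (((mem_filter.mp hf).2.1).trans ((mem_filter.mp hf').2.1).symm)

/-- `hscale`: component cubes have the step's scale. [folklore] -/
theorem hscale_R (K : ℕ) : ∀ k (b : (BR K).Birth), ∀ q ∈ compR K k b, (BR K).cubeScale q = k := fun _ _ _ hq => (mem_filter.mp hq).2

/-- `hvol`: component volume `v = 1` (ATTAINED below the cutoff: the scale-`k` cube). [folklore] -/
theorem hvol_R (K : ℕ) : ∀ k (b : (BR K).Birth), (compR K k b).card ≤ 1 :=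
  fun _ _ => card_le_one.mpr fun _ hq _ hq' => Fin.ext (((mem_filter.mp hq).2).trans ((mem_filter.mp hq').2).symm)

/-- **HOUSING, GENUINE** [decided toy]: every live family of a step-`k` component (`k ≤ K`) is felt at its cube; empty above `K`. [folklore] -/
theorem hhoused_R (K : ℕ) : ∀ k (b : (BR K).Birth), ∀ f ∈ SR K k b, ∃ q ∈ compR K k b, f ∈ (BR K).feltAt q := by
  intro k b f hf
  unfold SR at hf
  split_ifs at hf with hk
  · exact ⟨⟨k, Nat.lt_succ_of_le hk⟩, mem_filter.mpr ⟨Finset.mem_univ _, rfl⟩, mem_filter.mpr ⟨Finset.mem_univ _, (mem_filter.mp hf).2⟩⟩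
  · exact absurd hf (Finset.notMem_empty f)

/-- `hcv`: the ℝ-step's component volume `vR = 1` (singletons — ATTAINED). [folklore] -/
theorem compVol_RsR (K : ℕ) : (RsR K).CompVol 1 := fun _ => (Finset.card_singleton _).le

/-- **THE SEAM AS AN EQUALITY** [decided toy]: the pre-ℝ size at `k+1` IS the rate times the dressed envelope at `k`. [folklore] -/
theorem preBelowEnv_eq (K : ℕ) (b : (BR K).Birth) (k : ℕ) :
    (RsR K).pre b (k + 1) = (((2 : ℝ) ^ 2)⁻¹ * 1) * (TR K).envVar (4 * 1 / 1) (fun _ : ℕ => ((2 : ℝ) ^ 2)⁻¹ * 1) b k := by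
  show preR K b (k + 1) = _
  unfold preR
  rw [Nat.add_sub_cancel]

/-- `hpre` — PRE-SIZES BELOW THE TRANSPORTED ENVELOPE (indeed equal; any gate). [folklore] -/
theorem preBelowEnv_RsR (K : ℕ) (Gate : ℕ → Prop) :
    (TR K).PreBelowEnv (RsR K) (4 * 1 / 1) (fun _ : ℕ => ((2 : ℝ) ^ 2)⁻¹ * 1) Gate :=
  fun b k _ _ _ => (preBelowEnv_eq K b k).le

/-- [folklore] THE ABSORBED PRE-ℝ MASS IN CLOSED FORM: `Σ_{b₀ ∈ absorbs (j+1)} pre b₀ (j+1) = 3·cR K j` (= `ψ·(4·gen)` of family `j`). -/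
theorem absorbed_sum_eq (K j : ℕ) (hj : j + 1 ≤ K) :
    ∑ b₀ ∈ (RsR K).absorbs ⟨j + 1, Nat.lt_succ_of_le hj⟩, (RsR K).pre b₀ (j + 1) = 3 * cR K j := by
  show ∑ b₀ ∈ absorbsR K ⟨j + 1, Nat.lt_succ_of_le hj⟩, preR K b₀ (j + 1) = 3 * cR K j
  dsimp only [absorbsR]
  rw [if_pos (show 1 ≤ j + 1 by omega), Finset.sum_singleton]
  unfold preR
  have hb : (TR K).envVar (4 * 1 / 1) (fun _ : ℕ => ((2 : ℝ) ^ 2)⁻¹ * 1) ⟨j + 1 - 1, by omega⟩ (j + 1 - 1) =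
      4 * 1 / 1 * (TR K).gen ⟨j + 1 - 1, by omega⟩ (j + 1 - 1) := Trajectory.envVar_birth (4 * 1 / 1) _ _
  rw [hb]
  show ((2 : ℝ) ^ 2)⁻¹ * 1 * (4 * 1 / 1 * (if j + 1 - 1 = j + 1 - 1 then 3 * cR K (j + 1 - 1) else 0)) = 3 * cR K j
  rw [if_pos rfl, Nat.add_sub_cancel]
  ring

/-- [folklore] The oldest family absorbs nobody (so its birth is the dressing alone — at HALF the class, §5). -/
theorem absorbs_zero (K : ℕ) : (RsR K).absorbs ⟨0, Nat.succ_pos K⟩ = ∅ := by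
  show absorbsR K ⟨0, Nat.succ_pos K⟩ = ∅
  dsimp only [absorbsR]
  rw [if_neg (show ¬ (1 ≤ 0) by omega)]

/-- `hlaw` — **THE ABSORPTION LAW WITH EQUALITY AND A LIVE A-TERM** [decided toy]: `4·gen b b = βR K b + ⅛·Σ_{absorbs b} pre b₀ b` at
EVERY birth — the dressing (half the class) PLUS one eighth of the absorbed next-older family's pre-ℝ mass. [folklore] -/
theorem absorbLaw_eq (K : ℕ) (b : (BR K).Birth) :
    4 * 1 / 1 * (TR K).gen b ((BR K).birthScale b) =
      βR K ((BR K).birthScale b) + 1 / 8 * ∑ b₀ ∈ (RsR K).absorbs b, (RsR K).pre b₀ ((BR K).birthScale b) := by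
  obtain ⟨i, hi⟩ := b
  change 4 * 1 / 1 * (if i = i then 3 * cR K i else 0) = βR K i + 1 / 8 * ∑ b₀ ∈ (RsR K).absorbs ⟨i, hi⟩, (RsR K).pre b₀ i
  rw [if_pos rfl]
  cases i with
  | zero =>
    rw [absorbs_zero, Finset.sum_empty, mul_zero, add_zero]
    unfold βR
    rw [Nat.sub_zero]
    linarith [cR_zero K]
  | succ j =>
    rw [absorbed_sum_eq K j (Nat.lt_succ_iff.mp hi)]
    unfold βR
    linarith [cR_succ K j]

/-- `hlaw` in row S3u's letters. [folklore] -/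
theorem absorbLaw_RsR (K : ℕ) : (TR K).AbsorbLaw (RsR K) (4 * 1 / 1) (βR K) (1 / 8) := fun b => (absorbLaw_eq K b).le

/-- `hβ` with EQUALITY at `β₀ = ½`: the dressing IS `½·(2⁻¹^3)^(K−j)`. [folklore] -/
theorem hβ_R (K : ℕ) : ∀ j, j ≤ (BR K).K → βR K j ≤ 1 / 2 * ((2 : ℝ)⁻¹ ^ 3) ^ ((BR K).K - j) := fun j _ => by
  show βR K j ≤ 1 / 2 * ((2 : ℝ)⁻¹ ^ 3) ^ (K - j)
  unfold βR
  norm_num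

end Summit.QuantumFields.BalabanUV.T4Continuum.NE1p.DressedSuppliedAbsorptionWitness

end
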